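import Literature.AlgebraicGeometry.Motives.GeneratesHomExtReduced
import Literature.NumberTheory.Automorphic.Liu2021.AppendixC.AlbaneseNeronPackage
import HarnessLib

/-!
# The extended Albanese difference morphism is `1` off `∇X` on field-valued points (the dichotomy «on `∇X`, or `αd = 1`»)
# ([Liu2021] Def. 2.1 (1), Def. 2.3; [GortzWedhorn2020] Prop. 3.5; [Lang1983AbelianVarieties] II §3)

Topic `Literature/NumberTheory/Automorphic/Liu2021/AppendixC`.  THEOREMS only (no def, no instance, no notation, no named fact, no `sorry`).
Cell `hodgecm-mathlib` (D-0151), FLOOR 0, programme F0P5a (D9op road 2′, crux item stmt-HodgeConjecture-24832): piece **(A″)** of the ED. 4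
composition of `Cruxes/HLiu418/Lines/F0_D9opRoad2.lean` (hand-back memo `ED4-PEN-HANDBACK.v0` §2 step 3 «the off-`∇` case»; F0P5a-p05 (g0) PEN
design 2026-08-30T23:43Z, private lemma L3 of `EichlerShimuraPointwiseOfCongruence`): the clopen extension `αd : X × X → Alb_X` of the Albanese
morphism `α_X : ∇X → Alb_X` (★ `exists_desc_eq_one_of_isClopen`, ★ `Albanese.exists_albDiff`) takes the value `1` at every FIELD-VALUED point
of `X × X` that does not lie on `∇X` — because a morphism from the spectrum of a field either factors through the open subscheme `∇X` or lands in
its (closed) complement.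

* `AlgPoints.exists_map_eq_or_range_subset_compl` — for an open immersion `j : W ↪ Y` and an `L`-point `P` of `Y`: either `P` lifts along `j`,
  or the image of `Spec L → Y` misses `j(W)` (Mathlib `IsOpenImmersion.lift`; the same lifting as ★ `AlgPoints.range_map_of_isOpenImmersion_holds`).
* `Nabla.comp_eq_one_of_not_exists` — for a carrier `∇X ↪ X × X` and ANY `αd : X × X → G` that is `1` on every scheme mapping into the
  complement of `∇X` (the second conjunct of ★ `exists_desc_eq_one_of_isClopen`), an `L`-point `P` of `X × X` with no lift to `∇X` has `P ≫ αd = 1`;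
  dichotomy form `Nabla.exists_comp_incl_eq_or_comp_eq_one`.
* `Albanese.exists_albDiff_eq_one` — **there is `αd : X × X → Alb_X` with `∇X ↪ X × X ≫ αd = α_X` such that every field-valued point of
  `X × X` either lies on `∇X` or has `αd`-value `1`** (and the primed form keeping the scheme-valued vanishing clause as well).

HC_CM is proved only modulo the 7 printed citations until rung 0 closes; this file is a generic leaf and changes no count.

## References
* [Liu2021] Y. Liu, *Fourier–Jacobi cycles and arithmetic relative trace formula*, Camb. J. Math. 9 (2021), §2.1 Def. 2.1 (1) (l. 1171–1174), Def. 2.3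
  (l. 1202–1208); App. D proof of Cor. D.9 (print p. 139).
* [GortzWedhorn2020] U. Görtz, T. Wedhorn, *Algebraic Geometry I* (2nd ed.), Prop. 3.5 (gluing of morphisms) and Section (4.7) (points).
* [Lang1983AbelianVarieties] S. Lang, *Abelian Varieties*, II §3 (p. 35).
-/

set_option autoImplicit false

noncomputable section

universe u

open CategoryTheory CategoryTheory.Limits AlgebraicGeometry MonoidalCategory CartesianMonoidalCategory
open scoped MonObj
open Literature.AlgebraicGeometry.Motives (SchemeOver AbelianVariety AlgPoints)

/-! ### §1 Field-valued points and an open immersion: lift, or miss the image -/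

namespace Literature.AlgebraicGeometry.Motives.AlgPoints

variable {k : Type u} [Field k] {W Y : SchemeOver k} {L : Type u} [Field L] [Algebra k L]

/-- The image of `Spec L → Y` underlying an `L`-point `P` is the single point `P.pt`. [cite: GortzWedhorn2020, Section (4.7)] -/
theorem range_left_base_eq (P : AlgPoints Y L) : Set.range ⇑P.left = {P.pt} := by
  ext y
  constructor
  · rintro ⟨x, rfl⟩
    obtain rfl : x = IsLocalRing.closedPoint L := Subsingleton.elim (α := ↥(Spec (CommRingCat.of L))) _ _
    rfl
  · rintro rfl
    exact ⟨IsLocalRing.closedPoint L, rfl⟩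

/-- **Lift, or miss**: for an open immersion `j : W ↪ Y` of `k`-schemes and an `L`-point `P` of `Y` (`L` a field), either `P` lifts to an
`L`-point of `W` along `j`, or the image of `Spec L → Y` is contained in the complement of `j(W)` (a one-point space maps into an open set or
into its complement; the lift is Mathlib `IsOpenImmersion.lift`, cf. ★ `AlgPoints.range_map_of_isOpenImmersion_holds`).
[cite: GortzWedhorn2020, Section (4.7)] -/
theorem exists_map_eq_or_range_subset_compl (j : W ⟶ Y) [IsOpenImmersion j.left] (P : AlgPoints Y L) :
    (∃ z : AlgPoints W L, AlgPoints.map j z = P) ∨ Set.range ⇑P.left ⊆ (Set.range ⇑j.left)ᶜ := by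
  by_cases hP : Set.range ⇑P.left ⊆ Set.range ⇑j.left
  · left
    refine ⟨Over.homMk (IsOpenImmersion.lift j.left P.toSpecHom hP) ?_, ?_⟩
    · rw [← Over.w j, IsOpenImmersion.lift_fac_assoc]; exact Over.w P
    · ext : 1
      simp only [AlgPoints.map, Over.comp_left, Over.homMk_left]
      exact IsOpenImmersion.lift_fac _ _ _
  · right
    rw [range_left_base_eq, Set.singleton_subset_iff] at hP ⊢
    exact hP

end Literature.AlgebraicGeometry.Motives.AlgPoints

/-! ### §2 A carrier `∇X ↪ X × X` and a morphism that is `1` off it -/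

namespace Literature.NumberTheory.Automorphic.Liu2021.AppendixC

variable {k : Type u} [Field k] {X : SchemeOver k} {L : Type u} [Field L] [Algebra k L]

namespace Nabla

/-- **Dichotomy for `∇X`**: an `L`-point `P` of `X × X` either lies on `∇X` (lifts along `∇X ↪ X × X`, an open immersion — Def. 2.1 (1)) or
`Spec L → X × X` misses `∇X`. [cite: Liu2021, §2.1 Def. 2.1 (1) (l. 1171–1174)] [cite: GortzWedhorn2020, Section (4.7)] -/
theorem exists_comp_incl_eq_or_range_subset_compl (N : Nabla X) (P : AlgPoints (X ⊗ X) L) :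
    (∃ z : AlgPoints N.N L, z ≫ N.incl = P) ∨ Set.range ⇑P.left ⊆ (Set.range ⇑N.incl.left)ᶜ := by
  haveI := N.isOpenImmersion_incl
  rcases AlgPoints.exists_map_eq_or_range_subset_compl N.incl P with ⟨z, hz⟩ | h
  · exact Or.inl ⟨z, by rw [← AlgPoints.map_apply]; exact hz⟩
  · exact Or.inr h

/-- **Off `∇X` the extension is `1`**: if `αd : X × X → G` is `1` on every `k`-scheme mapping into the complement of `∇X` (the second conjunct of
★ `exists_desc_eq_one_of_isClopen`, the hypothesis `hαd1` of the F0P5a PEN design), then every `L`-point `P` of `X × X` WITHOUT a lift to `∇X` has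
`P ≫ αd = 1`. [cite: Liu2021, §2.1 Def. 2.1 (1) and Def. 2.3] [cite: GortzWedhorn2020, Prop. 3.5] -/
theorem comp_eq_one_of_not_exists (N : Nabla X) {G : SchemeOver k} [GrpObj G] (αd : X ⊗ X ⟶ G)
    (hαd1 : ∀ {W : SchemeOver k} (w : W ⟶ X ⊗ X), Set.range ⇑w.left ⊆ (Set.range ⇑N.incl.left)ᶜ → w ≫ αd = 1)
    (P : AlgPoints (X ⊗ X) L) (hP : ¬ ∃ z : AlgPoints N.N L, z ≫ N.incl = P) : P ≫ αd = 1 := by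
  rcases N.exists_comp_incl_eq_or_range_subset_compl P with h | h
  · exact absurd h hP
  · exact hαd1 P h

/-- The same read through `AlgPoints.map`: `αd(P) = 1` in the group `G(L)`. [cite: Liu2021, §2.1 Def. 2.1 (1) and Def. 2.3] -/
theorem map_eq_one_of_not_exists (N : Nabla X) {G : SchemeOver k} [GrpObj G] (αd : X ⊗ X ⟶ G)
    (hαd1 : ∀ {W : SchemeOver k} (w : W ⟶ X ⊗ X), Set.range ⇑w.left ⊆ (Set.range ⇑N.incl.left)ᶜ → w ≫ αd = 1)
    (P : AlgPoints (X ⊗ X) L) (hP : ¬ ∃ z : AlgPoints N.N L, z ≫ N.incl = P) : AlgPoints.map αd P = 1 := by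
  rw [AlgPoints.map_apply]
  exact N.comp_eq_one_of_not_exists αd hαd1 P hP

/-- **Dichotomy with values**: every `L`-point `P` of `X × X` either lifts to `∇X` or has `P ≫ αd = 1`, for `αd` as in
`comp_eq_one_of_not_exists`. [cite: Liu2021, §2.1 Def. 2.1 (1) and Def. 2.3] [cite: GortzWedhorn2020, Prop. 3.5] -/
theorem exists_comp_incl_eq_or_comp_eq_one (N : Nabla X) {G : SchemeOver k} [GrpObj G] (αd : X ⊗ X ⟶ G)
    (hαd1 : ∀ {W : SchemeOver k} (w : W ⟶ X ⊗ X), Set.range ⇑w.left ⊆ (Set.range ⇑N.incl.left)ᶜ → w ≫ αd = 1)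
    (P : AlgPoints (X ⊗ X) L) : (∃ z : AlgPoints N.N L, z ≫ N.incl = P) ∨ P ≫ αd = 1 := by
  by_cases hP : ∃ z : AlgPoints N.N L, z ≫ N.incl = P
  · exact Or.inl hP
  · exact Or.inr (N.comp_eq_one_of_not_exists αd hαd1 P hP)

/-- A pair `(p, q)` of `L`-points of `X` not on `∇X` has `αd (p, q) = 1`. [cite: Liu2021, §2.1 Def. 2.1 (1) and Def. 2.3] -/
theorem map_lift_eq_one_of_not_exists (N : Nabla X) {G : SchemeOver k} [GrpObj G] (αd : X ⊗ X ⟶ G)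
    (hαd1 : ∀ {W : SchemeOver k} (w : W ⟶ X ⊗ X), Set.range ⇑w.left ⊆ (Set.range ⇑N.incl.left)ᶜ → w ≫ αd = 1)
    (p q : AlgPoints X L) (hpq : ¬ ∃ z : AlgPoints N.N L, z ≫ N.incl = lift p q) : AlgPoints.map αd (lift p q) = 1 :=
  N.map_eq_one_of_not_exists αd hαd1 (lift p q) hpq

end Nabla

/-! ### §3 The Albanese difference morphism extended by `1` -/

namespace Albanese

/-- **The clopen extension of the Albanese morphism, with BOTH its properties** ([Liu2021] Def. 2.3 with Def. 2.1 (1); gluing [GortzWedhorn2020]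
Prop. 3.5): for any Albanese datum `aX` of `X` there is `αd : X × X → Alb_X` with `∇X ↪ X × X ≫ αd = α_X` which is `1` on every `k`-scheme
mapping into the complement of `∇X` — ★ `exists_desc_eq_one_of_isClopen` verbatim at `j := aX.nabla.incl`, `f := aX.α` (★ `Albanese.exists_albDiff`
keeps only the first conjunct). [cite: Liu2021, Def. 2.3 (l. 1202–1208) and Def. 2.1 (1) (l. 1171–1174)] [cite: GortzWedhorn2020, Prop. 3.5 (gluing of morphisms)] -/
theorem exists_albDiff_eq_one' (aX : Albanese X) :
    ∃ αd : X ⊗ X ⟶ aX.Alb.X, aX.nabla.incl ≫ αd = aX.α ∧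
      ∀ {W : SchemeOver k} (w : W ⟶ X ⊗ X), Set.range ⇑w.left ⊆ (Set.range ⇑aX.nabla.incl.left)ᶜ → w ≫ αd = 1 := by
  haveI := aX.nabla.isOpenImmersion_incl
  haveI := aX.nabla.isClosedImmersion_incl
  exact Literature.AlgebraicGeometry.Motives.exists_desc_eq_one_of_isClopen aX.nabla.incl (G := aX.Alb.X) aX.α

/-- **`αd` is `1` off `∇X` on field-valued points** (the dichotomy consumed by the off-`∇` case of the Eichler–Shimura composition, [Liu2021] App. D
p. 139): there is `αd : X × X → Alb_X` with `∇X ↪ X × X ≫ αd = α_X` such that for every field `L` over `k` and every `L`-point `P` of `X × X`,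
EITHER `P` lies on `∇X` (`∃ z, z ≫ incl = P`) OR `αd(P) = 1` in `Alb_X(L)`. [cite: Liu2021, Def. 2.3 (l. 1202–1208) and App. D proof of Cor. D.9 (print p. 139)]
[cite: GortzWedhorn2020, Prop. 3.5 (gluing of morphisms)] [cite: Lang1983AbelianVarieties, II §3 (p. 35)] -/
theorem exists_albDiff_eq_one (aX : Albanese X) :
    ∃ αd : X ⊗ X ⟶ aX.Alb.X, aX.nabla.incl ≫ αd = aX.α ∧
      ∀ {L : Type u} [Field L] [Algebra k L] (P : AlgPoints (X ⊗ X) L),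
        (∃ z : AlgPoints aX.nabla.N L, z ≫ aX.nabla.incl = P) ∨ AlgPoints.map αd P = 1 := by
  obtain ⟨αd, hαd, hαd1⟩ := aX.exists_albDiff_eq_one'
  refine ⟨αd, hαd, fun P => ?_⟩
  rcases aX.nabla.exists_comp_incl_eq_or_comp_eq_one αd hαd1 P with h | h
  · exact Or.inl h
  · exact Or.inr (by rw [AlgPoints.map_apply]; exact h)

end Albanese

end Literature.NumberTheory.Automorphic.Liu2021.AppendixC

end
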